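import Summits.BirchSwinnertonDyer.Rank1Residual.Additive.ZpTowerKernelH1
import Summits.BirchSwinnertonDyer.Rank1Residual.Additive.EmbeddingPlaceFactorisation
import Summits.BirchSwinnertonDyer.Rank1Residual.Additive.LocalSubgroupTransport
import Literature.NumberTheory.EllipticCurves.SubgroupSelmerProofs
import HarnessLib

/-!
# T-res (second half), file D: `kerH1Iso` carries the local Selmer conditions over `K_n` at the
# finite places into those over `K` (cell `b2b-bsdres`, n1011, p17 GEN 4; r2 ROUTE-2 §II.17.7)

HONEST FRAMING (cell `b2b-bsdres`, verbatim in every file): prove what is provable now; nothing is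
booked; no label changes. THEOREMS only; NO Literature fact; no `sorry`.

For a `ℤ_p`-extension `κ` of a number field `K`, its layer `K_n = κ.layer n`, the restricted tower
`κ_n` (`hκn`), and p01's `kerH1Iso : H¹(ker κ_n, E_{K_n}[p^∞]) ≃+ H¹(ker κ, E[p^∞])`
(`Additive/ZpTowerKernelH1.lean`):

* `kerH1Iso_mem_localKerOverOfEmb_of_factorisation` — the GENERIC LOCAL STEP: for a `K`-field `E`,
  a `K_n`-field `E'`, `f : E → E'`, a `K`-embedding `ι : K̄ → Ē` and `ε : E' → Ē` with
  `ε ∘ f = (E → Ē)`, `ε|_{K_n} = ι ∘ ι_{K_n}⁻¹|_{K_n}` and `E' = ⟨f(E), K_n⟩`: if all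
  `Γ_{K_n}`-conjugates of `x` satisfy the local condition at `E'`, then `kerH1Iso x` satisfies the
  local condition at `ι` (file C's transfer lemma, fed with `ι₂ = IsAlgClosed.lift` over `E'` and
  `hfix` from the generation hypothesis);
* `kerH1Iso_mem_localKerOverOfEmb_adicCompletion` — FINITE PLACES: for every finite place `v` of
  `K` and EVERY `K`-embedding `ι : K̄ → K̄_v`, `kerH1Iso x ∈ localKerOverOfEmb p (ker κ) ι` for
  `x ∈ Sel_{p^∞}(E_{K_n}/K_{n,∞})` (file B's `exists_place_factorisation` + file A's
  `closure_range_adicCompletionMap_union_eq_top`);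
* `conjH1_kerH1Iso_mem_localKerOver_adicCompletion` — the same in the `conj_σ` form of
  `WeierstrassCurve.mem_selmerGroupOver_iff` (`localKerOverOfEmb_comp`).

The archimedean places and the assembled `kerH1Iso_mem_selmerGroupOver` are in the sequel file.

References: [SerreGaloisCohomology1997] II.§1.1; [GreenbergLNM1716] §2; [Mazur1972] §6.
-/

noncomputable section

open scoped Classical

open Literature.NumberTheory.EllipticCurves NumberField IsDedekindDomain
open Summit.BirchSwinnertonDyer.Rank1Residual.Additive.LocalTransport

universe u

namespace Summit.BirchSwinnertonDyer.Rank1Residual.Additive.ZpTower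

variable {K : Type u} [Field K] [NumberField K] {p : ℕ} [Fact p.Prime]
variable (W : WeierstrassCurve K) (κ : ZpExtension K p) (n : ℕ) (κn : ZpExtension (κ.layer n) p)
  (hκn : ∀ σ : Field.absoluteGaloisGroup (κ.layer n),
    (κn σ).toAdd * (p : ℤ_[p]) ^ n = (κ (resGal (K := K) (κ.layer n) σ)).toAdd)

/-! ## The generic local step -/

section Generic

variable {E : Type u} [Field E] [Algebra K E]
variable {E' : Type u} [Field E'] [Algebra K E'] [Algebra (κ.layer n) E']
  [IsScalarTower K (κ.layer n) E']

/-- **Generic local step.** See the module docstring. [cite: SerreGaloisCohomology1997, II.§1.1] -/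
theorem kerH1Iso_mem_localKerOverOfEmb_of_factorisation
    (ι : AlgebraicClosure K →ₐ[K] AlgebraicClosure E) (f : E →+* E')
    (ε : E' →+* AlgebraicClosure E) (hεf : ε.comp f = algebraMap E (AlgebraicClosure E))
    (hεL : ∀ l : κ.layer n, ε (algebraMap (κ.layer n) E' l) =
      ι ((algEquivOfEmb (κ.layer n) (closureEmb (K := K) (κ.layer n))).symm
        (algebraMap (κ.layer n) (AlgebraicClosure (κ.layer n)) l)))
    (hgen : Subring.closure (Set.range f ∪ Set.range (algebraMap (κ.layer n) E')) = ⊤)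
    (x : (W.baseChange (κ.layer n)).subgroupH1 p κn.kerSubgroup)
    (hx : ∀ σ : Field.absoluteGaloisGroup (κ.layer n),
      (W.baseChange (κ.layer n)).conjH1 p κn.kerSubgroup σ x ∈
        (W.baseChange (κ.layer n)).localKerOver p κn.kerSubgroup E') :
    kerH1Iso W κ n κn hκn x ∈ W.localKerOverOfEmb p κ.kerSubgroup ι := by
  let ιL : AlgebraicClosure K ≃ₐ[K] AlgebraicClosure (κ.layer n) :=
    algEquivOfEmb (κ.layer n) (closureEmb (K := K) (κ.layer n))
  -- (1) `Ē` is an algebraic `E'`-algebra through `ε`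
  letI : Algebra E' (AlgebraicClosure E) := ε.toAlgebra
  letI : Algebra E E' := f.toAlgebra
  haveI : IsScalarTower E E' (AlgebraicClosure E) :=
    IsScalarTower.of_algebraMap_eq fun a ↦ (RingHom.congr_fun hεf a).symm
  haveI : Algebra.IsAlgebraic E' (AlgebraicClosure E) := Algebra.IsAlgebraic.tower_top (K := E) E'
  -- (2) `ι₂ : Ē ≃ Ē'` over `E'`
  let ι₂₀ : AlgebraicClosure E →ₐ[E'] AlgebraicClosure E' := IsAlgClosed.lift
  have hι₂bij : Function.Bijective ι₂₀ := by
    letI : Algebra (AlgebraicClosure E) (AlgebraicClosure E') := ι₂₀.toRingHom.toAlgebra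
    haveI : IsScalarTower E' (AlgebraicClosure E) (AlgebraicClosure E') :=
      IsScalarTower.of_algebraMap_eq fun y ↦ (ι₂₀.commutes y).symm
    haveI : Algebra.IsAlgebraic (AlgebraicClosure E) (AlgebraicClosure E') :=
      Algebra.IsAlgebraic.tower_top (K := E') (AlgebraicClosure E)
    exact IsAlgClosed.algebraMap_bijective_of_isIntegral
      (k := AlgebraicClosure E) (K := AlgebraicClosure E')
  let ι₂ : AlgebraicClosure E ≃+* AlgebraicClosure E' := RingEquiv.ofBijective ι₂₀.toRingHom hι₂bij
  have hι₂ε : ∀ y : E', ι₂ (ε y) = algebraMap E' (AlgebraicClosure E') y := fun y ↦ ι₂₀.commutes y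
  have hι₂symm : ∀ y : E', ι₂.symm (algebraMap E' (AlgebraicClosure E') y) = ε y := fun y ↦ by
    rw [← hι₂ε, RingEquiv.symm_apply_apply]
  -- (3) `ι' : L̄ → Ē'` over `K_n`, with `ι' ∘ ι_L = ι₂ ∘ ι`
  have hι'L : ∀ l : κ.layer n,
      ι₂ (ι (ιL.symm (algebraMap (κ.layer n) (AlgebraicClosure (κ.layer n)) l))) =
        algebraMap (κ.layer n) (AlgebraicClosure E') l := fun l ↦ by
    rw [← hεL l, hι₂ε, ← IsScalarTower.algebraMap_apply]
  let ι' : AlgebraicClosure (κ.layer n) →ₐ[κ.layer n] AlgebraicClosure E' :=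
    { ι₂.toRingHom.comp (ι.toRingHom.comp (ιL.symm : AlgebraicClosure (κ.layer n) →+*
        AlgebraicClosure K)) with
      commutes' := fun l ↦ hι'L l }
  have hι'apply : ∀ z', ι' z' = ι₂ (ι (ιL.symm z')) := fun _ ↦ rfl
  have hcompat : ∀ z, ι' (closureEmb (K := K) (κ.layer n) z) = ι₂ (ι z) := fun z ↦ by
    rw [hι'apply, ← algEquivOfEmb_apply (κ.layer n) (closureEmb (K := K) (κ.layer n)) z,
      AlgEquiv.symm_apply_apply]
  -- (4) the elements of `Γ_E` restricting into `ker κ` fix `ι₂⁻¹(E') = ε(E')`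
  have hfix : ∀ h : Field.absoluteGaloisGroup E, resGalOfEmb ι h ∈ κ.kerSubgroup → ∀ y : E',
      (show AlgebraicClosure E ≃ₐ[E] AlgebraicClosure E from h)
        (ι₂.symm (algebraMap E' (AlgebraicClosure E') y)) =
          ι₂.symm (algebraMap E' (AlgebraicClosure E') y) := by
    intro h hh y
    obtain ⟨σ', hσ'⟩ : resGalOfEmb ι h ∈ galRange (K := K) (κ.layer n) :=
      kerSubgroup_le_galRange_layer κ n hh
    rw [hι₂symm]
    have hσ : resGal (K := K) (κ.layer n) σ' = resGalOfEmb ι h := hσ'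
    have key : (((show AlgebraicClosure E ≃ₐ[E] AlgebraicClosure E from h) :
        AlgebraicClosure E →+* AlgebraicClosure E).comp ε) = ε := by
      refine RingHom.eq_of_eqOn_set_dense hgen ?_
      rintro _ (⟨a, rfl⟩ | ⟨l, rfl⟩)
      · have hfa : ε (f a) = algebraMap E (AlgebraicClosure E) a := RingHom.congr_fun hεf a
        change (show AlgebraicClosure E ≃ₐ[E] AlgebraicClosure E from h) (ε (f a)) = ε (f a)
        rw [hfa]
        exact AlgEquiv.commutes _ a
      · -- `ε l = ι z`, `z = ι_L⁻¹ l`; `h (ι z) = ι ((res_ι h) z)` and `res_ι h = resGal L σ'` fixes `z`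
        have hz : (show AlgebraicClosure K ≃ₐ[K] AlgebraicClosure K from resGalOfEmb ι h)
            (ιL.symm (algebraMap (κ.layer n) (AlgebraicClosure (κ.layer n)) l)) =
            ιL.symm (algebraMap (κ.layer n) (AlgebraicClosure (κ.layer n)) l) := by
          apply ιL.injective
          rw [← hσ]
          have e := algEquivOfEmb_resGal_apply (κ.layer n) σ'
            (ιL.symm (algebraMap (κ.layer n) (AlgebraicClosure (κ.layer n)) l))
          refine e.trans ?_
          change (show AlgebraicClosure (κ.layer n) ≃ₐ[κ.layer n] AlgebraicClosure (κ.layer n)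
            from σ') (ιL (ιL.symm _)) = ιL (ιL.symm _)
          rw [AlgEquiv.apply_symm_apply, AlgEquiv.commutes]
        change (show AlgebraicClosure E ≃ₐ[E] AlgebraicClosure E from h)
          (ε (algebraMap (κ.layer n) E' l)) = ε (algebraMap (κ.layer n) E' l)
        rw [hεL l]
        exact (apply_resGalAuxOfEmb_apply ι h _).symm.trans (congrArg ι hz)
    exact RingHom.congr_fun key y
  -- (5) the `K_n`-side local condition at `ι'`, and the transfer
  have hx' : (W.baseChange (κ.layer n)).localResOverOfEmb p κn.kerSubgroup ι' x = 0 := by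
    obtain ⟨τ, hτ⟩ :=
      (W.baseChange (κ.layer n)).exists_localKerOverOfEmb_eq_comap_holds p κn.kerSubgroup ι'
    have hmem : x ∈ (W.baseChange (κ.layer n)).localKerOverOfEmb p κn.kerSubgroup ι' := by
      rw [hτ]; exact hx τ
    exact hmem
  have h0 := localResOverOfEmb_resH1Hom_eq_zero (κ.layer n) κ.kerSubgroup κn.kerSubgroup
    (fun τ hτ ↦ (mem_kerSubgroup_restrictTower_iff κ n κn hκn τ).mpr hτ) ι ι₂ ι' hcompat hfix W p
    (kerOfKer κ n κn hκn) (resGal_kerOfKer κ n κn hκn)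
    (fun τ Q ↦ primaryBaseChangeEquiv_symm_kerOfKer_smul W κ n κn hκn τ Q) x hx'
  rw [WeierstrassCurve.localKerOverOfEmb, AddMonoidHom.mem_ker, kerH1Iso_apply]
  exact h0

end Generic

/-! ## Finite places -/

section Finite

/-- **Finite places.** For `x ∈ Sel_{p^∞}(E_{K_n}/K_{n,∞})` (Selmer conditions at the places of
`K_n`), every finite place `v` of `K` and EVERY `K`-embedding `ι : K̄ → K̄_v`, the class
`kerH1Iso x` dies in `H¹((res_ι)⁻¹(ker κ), E(K̄_v))`: the `K`-embedding `ι ∘ ι_{K_n}⁻¹|_{K_n}`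
factors through some `K_{n,w}`, `w ∣ v` (`exists_place_factorisation`), and the generic local step
applies with `E' = K_{n,w}`. [cite: GreenbergLNM1716, §2] -/
theorem kerH1Iso_mem_localKerOverOfEmb_adicCompletion (v : HeightOneSpectrum (𝓞 K))
    (ι : AlgebraicClosure K →ₐ[K] AlgebraicClosure (v.adicCompletion K))
    (x : (W.baseChange (κ.layer n)).subgroupH1 p κn.kerSubgroup)
    (hx : x ∈ (W.baseChange (κ.layer n)).selmerGroupOver p κn.kerSubgroup) :
    kerH1Iso W κ n κn hκn x ∈ W.localKerOverOfEmb p κ.kerSubgroup ι := by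
  let ιL : AlgebraicClosure K ≃ₐ[K] AlgebraicClosure (κ.layer n) :=
    algEquivOfEmb (κ.layer n) (closureEmb (K := K) (κ.layer n))
  let φ : κ.layer n →+* AlgebraicClosure (v.adicCompletion K) :=
    ι.toRingHom.comp ((ιL.symm : AlgebraicClosure (κ.layer n) →+* AlgebraicClosure K).comp
      (algebraMap (κ.layer n) (AlgebraicClosure (κ.layer n))))
  have hφapply : ∀ l, φ l = ι (ιL.symm (algebraMap (κ.layer n) (AlgebraicClosure (κ.layer n)) l)) :=
    fun _ ↦ rfl
  have hφ : φ.comp (algebraMap K (κ.layer n)) =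
      (algebraMap (v.adicCompletion K) (AlgebraicClosure (v.adicCompletion K))).comp
        (algebraMap K (v.adicCompletion K)) := by
    ext x
    change φ (algebraMap K (κ.layer n) x) =
      algebraMap (v.adicCompletion K) _ (algebraMap K (v.adicCompletion K) x)
    rw [hφapply, ← IsScalarTower.algebraMap_apply K (κ.layer n) (AlgebraicClosure (κ.layer n)),
      AlgEquiv.commutes, AlgHom.commutes, ← IsScalarTower.algebraMap_apply]
  obtain ⟨w, hw, ε, hεf, hεφ⟩ := exists_place_factorisation (κ.layer n) v
    (algebraMap (v.adicCompletion K) (AlgebraicClosure (v.adicCompletion K))) φ hφ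
  exact kerH1Iso_mem_localKerOverOfEmb_of_factorisation W κ n κn hκn ι
    (adicCompletionMap (K := K) (κ.layer n) v w) ε hεf
    (fun l ↦ (RingHom.congr_fun hεφ l).trans (hφapply l))
    (closure_range_adicCompletionMap_union_eq_top (κ.layer n) v w) x
    (fun σ ↦ (((W.baseChange (κ.layer n)).mem_selmerGroupOver_iff p κn.kerSubgroup x).1 hx).1 w σ)

/-- The same in the `conj_σ` form of `mem_selmerGroupOver_iff`: for every finite place `v` of `K`
and every `σ ∈ Γ_K`, `conj_σ (kerH1Iso x)` dies at the chosen place above `v`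
(`localKerOverOfEmb_comp`: `conj_σ c ∈ localKerOver K_v ↔ c ∈ localKerOverOfEmb (closureEmb ∘ σ)`).
[cite: GreenbergLNM1716, §2] -/
theorem conjH1_kerH1Iso_mem_localKerOver_adicCompletion (v : HeightOneSpectrum (𝓞 K))
    (σ : Field.absoluteGaloisGroup K)
    (x : (W.baseChange (κ.layer n)).subgroupH1 p κn.kerSubgroup)
    (hx : x ∈ (W.baseChange (κ.layer n)).selmerGroupOver p κn.kerSubgroup) :
    W.conjH1 p κ.kerSubgroup σ (kerH1Iso W κ n κn hκn x) ∈
      W.localKerOver p κ.kerSubgroup (v.adicCompletion K) := by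
  have h := kerH1Iso_mem_localKerOverOfEmb_adicCompletion W κ n κn hκn v
    ((closureEmb (K := K) (v.adicCompletion K)).comp
      ((show AlgebraicClosure K ≃ₐ[K] AlgebraicClosure K from σ) :
        AlgebraicClosure K →ₐ[K] AlgebraicClosure K)) x hx
  rw [W.localKerOverOfEmb_comp p κ.kerSubgroup, AddSubgroup.mem_comap] at h
  rw [WeierstrassCurve.localKerOver_eq_ofEmb]
  exact h

end Finite

end Summit.BirchSwinnertonDyer.Rank1Residual.Additive.ZpTower

end
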